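import Summits.ResolutionOfSingularities.ResolutionOfSingularities.Theorems.FrobeniusClosingSteerToricConcl

/-!
# Crux `Steer` (stmt-ResolutionOfSingularities-16345) — §σ2.28 PROVER'S TOOL, part 3: the EDGE case (a Jacobian unit from a
# chart identity `z₀ = c + H(z)` with `H` carrying a positive-value letter in every monomial)

OURS (campaign res-hironaka, rung L ★L-G4, slot W4.1; res-type-028 g10; asked by res-L0-w41-strat-2 §12 (3) 2026-08-27T12:45:17Z as
the checkable sufficient condition res-type-054's U11b cites). Theses-free; `--supports stmt-ResolutionOfSingularities-16345`, counted 0.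
NOT a statement of the manuscript under review [claim: Hironaka2017, status: under-review]; AI seat, weaker than expert review.

THE EDGE MECHANISM (strat-2's (H1)–(H4), written in the chart). Along an EDGE-ADAPTED cone for a radicand with MONOMIAL initial form
`f = c·x^M + h` (`c ∈ kˣ`, row `m₀ = (p; −M)` so that `z₀ = s^p / x^M = f / x^M`, every other monomial of `f` dominating `x^M` in every
ray of the cone), the torsor equation divided by `x^M` reads, in the chart letters, `z₀ = c + H(z)` where EVERY monomial of `H` involves
some letter `z_j`, `j ≠ 0` — and those letters have POSITIVE value (`v(z_j) < 1` multiplicatively). Then `G := Z₀ − c − H` vanishes at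
`z` and `∂G/∂Z₀ (z) = 1 − (∂H/∂Z₀)(z)` is a UNIT of `O`, because differentiating in `Z₀` does not remove the positive-value letter from any
monomial (ultrametric inequality). This is exactly the hypothesis `hJ` (with `j = 0`) of (E1)/(E3) (`…Theorems.FrobeniusClosingSteerToricExitCriterion`
/ `…ToricExitProducer`): `jacobianUnit_of_edge`. The translation «(H1)–(H3) on `f` ⇒ such an `H` exists» is per-instance exponent
bookkeeping (054's script); a typed `MvPolynomial`-level version can follow on request. [folklore]
-/

noncomputable section

-- single-problem summit: the doubled namespace component `ResolutionOfSingularities` is forced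
set_option linter.dupNamespace false

open scoped BigOperators

namespace Summit.ResolutionOfSingularities.ResolutionOfSingularities.Theorems.SteerToricExitCriterion

open MvPolynomial

variable {k K : Type} [Field k] [Field K] [Algebra k K]

/-- The value of a chart monomial `a · z^e` is `< 1` as soon as `e` involves a letter of value `< 1` (all letters and the coefficient lying
in `O`). [folklore] -/
theorem valuation_aeval_monomial_lt_one (O : ValuationSubring K) (hk : ∀ c : k, algebraMap k K c ∈ O)
    {N : ℕ} (z : Fin N → K) (hzO : ∀ j, z j ∈ O) (e : Fin N →₀ ℕ) (a : k)
    {j : Fin N} (hj : e j ≠ 0) (hzj : O.valuation (z j) < 1) :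
    O.valuation (aeval z (monomial e a)) < 1 := by
  classical
  rw [aeval_monomial, map_mul, Finsupp.prod_fintype _ _ (fun i => by simp), map_prod]
  have h1 : O.valuation (algebraMap k K a) ≤ 1 := (O.valuation_le_one_iff _).mpr (hk a)
  have h2 : ∏ i, O.valuation (z i ^ e i) < 1 := by
    rw [← Finset.prod_erase_mul _ _ (Finset.mem_univ j)]
    have hle : ∏ i ∈ Finset.univ.erase j, O.valuation (z i ^ e i) ≤ 1 := by
      refine Finset.prod_le_one' fun i _ => ?_
      rw [map_pow]
      exact pow_le_one' ((O.valuation_le_one_iff _).mpr (hzO i)) _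
    have hlt : O.valuation (z j ^ e j) < 1 := by
      rw [map_pow]
      exact pow_lt_one' hzj hj
    calc (∏ i ∈ Finset.univ.erase j, O.valuation (z i ^ e i)) * O.valuation (z j ^ e j)
        ≤ 1 * O.valuation (z j ^ e j) := mul_le_mul_left hle _
      _ < 1 := by rw [one_mul]; exact hlt
  calc O.valuation (algebraMap k K a) * ∏ i, O.valuation (z i ^ e i)
      ≤ 1 * ∏ i, O.valuation (z i ^ e i) := mul_le_mul_left h1 _
    _ < 1 := by rw [one_mul]; exact h2

/-- If every monomial of `H ∈ k[Z₀..Z_N]` involves some letter `Z_j`, `j ≠ 0`, of value `< 1` at `z`, then so does every monomial of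
`∂H/∂Z₀`, and `(∂H/∂Z₀)(z)` has value `< 1`. [folklore] -/
theorem valuation_aeval_pderiv_zero_lt_one (O : ValuationSubring K) (hk : ∀ c : k, algebraMap k K c ∈ O)
    {N : ℕ} (z : Fin (N + 1) → K) (hzO : ∀ j, z j ∈ O) (hzpos : ∀ j, j ≠ 0 → O.valuation (z j) < 1)
    (H : MvPolynomial (Fin (N + 1)) k) (hH : ∀ e ∈ H.support, ∃ j, j ≠ 0 ∧ e j ≠ 0) :
    O.valuation (aeval z (pderiv 0 H)) < 1 := by
  classical
  conv_lhs => rw [H.as_sum, map_sum, map_sum]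
  refine O.valuation.map_sum_lt one_ne_zero fun e he => ?_
  obtain ⟨j, hj0, hj⟩ := hH e he
  rw [pderiv_monomial]
  refine valuation_aeval_monomial_lt_one O hk z hzO _ _ (j := j) ?_ (hzpos j hj0)
  rw [Finsupp.coe_tsub, Pi.sub_apply, Finsupp.single_eq_of_ne hj0, tsub_zero]
  exact hj

/-- **(E4) EDGE ⇒ JACOBIAN UNIT.** In the chart letters `z : Fin (N+1) → K` (all in `O` ⊇ `k`, and `v(z_j) < 1` for `j ≠ 0`), suppose the
chart identity `z₀ = c + H(z)` with `c ∈ k` and `H ∈ k[Z₀..Z_N]` ALL of whose monomials involve some `Z_j`, `j ≠ 0` (the EDGE case: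
monomial initial form, edge-adapted cone — `z₀ = f / x^M`, `c` = the initial coefficient, `H` = the other monomials of `f / x^M` in the
chart). Then `G := Z₀ − c − H` has `G(z) = 0` and `∂G/∂Z₀ (z) = 1 − (∂H/∂Z₀)(z)` of value `1`: the hypotheses `hG`, `hJ` (with `j = 0`) of
(E1) `isRegularLocalRing_locAtCentre_of_jacobianUnit` / (E3) `toricExitAt_of_jacobianUnit`. OURS. [folklore] -/
theorem jacobianUnit_of_edge (O : ValuationSubring K) (hk : ∀ c : k, algebraMap k K c ∈ O)
    {N : ℕ} (z : Fin (N + 1) → K) (hzO : ∀ j, z j ∈ O) (hzpos : ∀ j, j ≠ 0 → O.valuation (z j) < 1)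
    (c : k) (H : MvPolynomial (Fin (N + 1)) k) (hH : ∀ e ∈ H.support, ∃ j, j ≠ 0 ∧ e j ≠ 0)
    (hz0 : z 0 = algebraMap k K c + aeval z H) :
    aeval z (X 0 - C c - H) = 0 ∧
      ∃ j, O.valuation (aeval z (pderiv j (X 0 - C c - H))) = 1 := by
  refine ⟨?_, 0, ?_⟩
  · rw [map_sub, map_sub, aeval_X, aeval_C, hz0]; ring
  · have hp : pderiv 0 (X 0 - C c - H : MvPolynomial (Fin (N + 1)) k) = 1 - pderiv 0 H := by
      rw [map_sub, map_sub, pderiv_X_self, pderiv_C, sub_zero]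
    have ha : aeval z (pderiv 0 (X 0 - C c - H : MvPolynomial (Fin (N + 1)) k)) = 1 - aeval z (pderiv 0 H) := by
      rw [hp, map_sub, map_one]
    rw [ha]
    exact O.valuation.map_one_sub_of_lt (valuation_aeval_pderiv_zero_lt_one O hk z hzO hzpos H hH)

end Summit.ResolutionOfSingularities.ResolutionOfSingularities.Theorems.SteerToricExitCriterion

end
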